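import Literature.Combinatorics.HironakaPolyhedraGame.MonomialMarkedGame

/-!
# The marked monomial game — part B: the junior (link) game at a contact ray and the resolution theorem

Sources: [Blanco2012a] §3.1–3.3 (E-maximal contact, coefficient ideals along `E`, junior ideals: Def. 3.17,
Prop. 3.11–3.13), §4 (Prop. 4.1, Algorithm 4.4, **Thm. 4.6**); [EncinasVillamayor1998] §2 (monomial case).

Part A (`MonomialMarkedGame.lean`) set up the abstract game `MGame`, the history-free bookkeeping `J = M · I`
(`alpha`/`pexp`/`theta` relative to the names `OLD` present at the start), the phase facts and the monomial phase.
This file proves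

* `MGame.solvable_of_wf` — **every well-formed state of the marked monomial game, in every dimension `n`, is
  solvable** (an E-resolution of every marked monomial ideal on every «fan stage» exists; the dimension-free core of
  [Blanco2012a, Thm. 4.6] for monomial ideals),

by induction on `n`.  Inside a dimension: an outer induction on `N · θ_max` (the maximal residual order among the
not-done cones; `θ_max = 0` is the monomial phase of part A); for `θ_max = θ > 0` every active cone has a CONTACT ray
`r` (part A), and the JUNIOR GAME at `r` — the coefficient ideal of the companion pair on the hypersurface of the ray,
[Blanco2012a, Def. 3.17 / Alg. 4.4 steps 3–5], here `MGame.link`: cones `D − r`, generators `{v : p_r(v) < θ} ⊔ {M if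
α_r < 1 − θ}`, exponents `p_x(v)/(θ − p_r(v))` and `α_x/(1 − θ − α_r)` — is an `(n−1)`-dimensional state of the SAME game
whose legal moves, done cones and transforms correspond exactly to the allowed moves `R′ ∪ {r}`, the inactive cones and
the transforms upstairs (`legal_insert_of_link_legal`, `link_done_iff`, `link_move`; [Blanco2012a, Prop. 3.12, 3.13,
4.1]).  The one device that is ours: the phase is finished ONE CONTACT RAY AT A TIME — the junior game of the active
cones through `r` is solved by the induction hypothesis and REPLAYED upstairs (`replay`), the other active cones keep
(inherited) contact rays in a shrinking finite set, and finished cones are never touched again (`phase`); no resolution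
invariant `t` ([Blanco2012a, Def. 3.20]) is needed for existence.

Everything is proved; no named fact is introduced; no instance, no notation.  Not here: the transport to the fan-stage
rendering `HStageN` of `MonomialEResolution.lean` (which additionally needs the fan/coherence invariant of reachable
stages) — a separate file.
-/

namespace Literature.Combinatorics.HironakaPolyhedraGame

open Finset
open scoped BigOperators

namespace MGame

variable {ι : Type}

/-! ## §6 The junior (link) game at a contact ray -/

section Link

variable [Fintype ι] [Nonempty ι]

/-- Generators of the JUNIOR GAME at a ray with residual exponents `pr` and monomial exponent `ar`, at level `θ`:
the generators `v` with `p_r(v) < θ` (those contributing a coefficient of `x_r`-degree `< θ`), and the monomial part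
`M` when `α_r < 1 − θ` (the factor `M^{θ/(c−θ)}` of the companion ideal).  [cite: Blanco2012a, Def. 3.17, Alg. 4.4
(steps 3–5)] -/
abbrev LinkGen (ι : Type) (θ : ℚ) (pr : ι → ℚ) (ar : ℚ) : Type :=
  {v : ι // pr v < θ} ⊕ {_u : Unit // ar < 1 - θ}

/-- Exponents of the junior game: `p_x(v)/(θ − p_r(v))` for a generator `v`, `α_x/(1 − θ − α_r)` for `M` — the
E-coefficient ideal of the companion pair with its marking normalised to `1`.  [cite: Blanco2012a, Def. 3.17 with
Prop. 3.12] -/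
def linkExpo (θ : ℚ) (pr : ι → ℚ) (ar : ℚ) (p : ℕ → ι → ℚ) (a : ℕ → ℚ) : ℕ → LinkGen ι θ pr ar → ℚ
  | x, Sum.inl v => p x v.1 / (θ - pr v.1)
  | x, Sum.inr _u => a x / (1 - θ - ar)

/-- THE JUNIOR (LINK) GAME at the ray `r` for the family `𝒟` of cones through `r`: cones `D − r`, exponents
`linkExpo` computed from the current residual/monomial exponents, same used names.  [cite: Blanco2012a, Def. 3.17,
Alg. 4.4 (steps 3–5)] -/
def link (OLD : Finset ℕ) (θ : ℚ) (pr : ι → ℚ) (ar : ℚ) (s : MGame ι) (r : ℕ) (𝒟 : Finset (Finset ℕ)) :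
    MGame (LinkGen ι θ pr ar) where
  cones := 𝒟.image (fun D => D.erase r)
  expo := linkExpo θ pr ar (fun x v => s.pexp OLD x v) (fun x => s.alpha OLD x)
  used := s.used

variable {OLD : Finset ℕ} {θ : ℚ} {pr : ι → ℚ} {ar : ℚ} {n : ℕ}

/-- The hypotheses under which the junior game at `r` mirrors the phase upstairs: well-formed state, `r`'s data frozen
at `(pr, ar)`, the family `𝒟` consists of cones through `r` of residual order `≤ θ`, and `θ` bounds the residual
order of every not-done cone.  [cite: Blanco2012a, Prop. 4.1] -/
structure LinkInv (OLD : Finset ℕ) (θ : ℚ) (pr : ι → ℚ) (ar : ℚ) (n : ℕ) (s : MGame ι) (r : ℕ)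
    (𝒟 : Finset (Finset ℕ)) : Prop where
  wf : s.WF n
  old_sub : OLD ⊆ s.used
  r_used : r ∈ s.used
  pr_eq : ∀ v, s.pexp OLD r v = pr v
  ar_eq : s.alpha OLD r = ar
  sub : 𝒟 ⊆ s.cones
  mem_r : ∀ D ∈ 𝒟, r ∈ D
  theta_le : ∀ D ∈ 𝒟, s.theta OLD D ≤ θ
  bound : ∀ C ∈ s.cones, ¬ s.Done C → s.theta OLD C ≤ θ

/-- `(D − r) ∪ {r} = D` for cones through `r`. [folklore] -/
private theorem insert_erase_of_mem {D : Finset ℕ} {r : ℕ} (h : r ∈ D) : insert r (D.erase r) = D :=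
  Finset.insert_erase h

/-- Face sums split off the ray `r`. [cite: Blanco2012a, Prop. 3.12] -/
theorem psum_insert (s : MGame ι) (OLD : Finset ℕ) {R' : Finset ℕ} {r : ℕ} (hr : r ∉ R') (v : ι) :
    s.psum OLD (insert r R') v = s.pexp OLD r v + s.psum OLD R' v := by
  unfold psum; rw [Finset.sum_insert hr]

/-- Monomial sums split off the ray `r`. [cite: Blanco2012a, Prop. 3.12] -/
theorem asum_insert (s : MGame ι) (OLD : Finset ℕ) {R' : Finset ℕ} {r : ℕ} (hr : r ∉ R') :
    s.asum OLD (insert r R') = s.alpha OLD r + s.asum OLD R' := by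
  unfold asum; rw [Finset.sum_insert hr]

/-- The link sum of a generator `v`: `Σ_{R'} p(v)/(θ − p_r(v))`. [cite: Blanco2012a, Def. 3.17] -/
theorem link_fsum_inl (s : MGame ι) (r : ℕ) (𝒟 : Finset (Finset ℕ)) (R' : Finset ℕ) (v : ι) (hv : pr v < θ) :
    (s.link OLD θ pr ar r 𝒟).fsum R' (Sum.inl ⟨v, hv⟩) = s.psum OLD R' v / (θ - pr v) := by
  unfold fsum link linkExpo psum
  simp only
  rw [Finset.sum_div]

/-- The link sum of the monomial generator: `Σ_{R'} α/(1 − θ − α_r)`. [cite: Blanco2012a, Def. 3.17] -/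
theorem link_fsum_inr (s : MGame ι) (r : ℕ) (𝒟 : Finset (Finset ℕ)) (R' : Finset ℕ)
    (u : {_u : Unit // ar < 1 - θ}) :
    (s.link OLD θ pr ar r 𝒟).fsum R' (Sum.inr u) = s.asum OLD R' / (1 - θ - ar) := by
  obtain ⟨_, _⟩ := u
  unfold fsum link linkExpo asum
  simp only
  rw [Finset.sum_div]

/-- **(L) JUNIOR-LEGAL ⟹ ALLOWED UPSTAIRS.**  A legal centre `R'` of the junior game at `r` lifts to the centre
`R' ∪ {r}` upstairs, which is legal and has residual order exactly `θ` («`Z ⊂ E-Sing(P_i, c_i) = E-Sing(I_i, θ) ∩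
E-Sing(M_i, c − θ)`», [Blanco2012a, Prop. 4.1 eq. (singP)]).  [cite: Blanco2012a, Prop. 4.1, Prop. 3.12] -/
theorem legal_insert_of_link_legal {s : MGame ι} {r : ℕ} {𝒟 : Finset (Finset ℕ)}
    (h : s.LinkInv OLD θ pr ar n r 𝒟) {R' : Finset ℕ} (hL : (s.link OLD θ pr ar r 𝒟).Legal R') :
    r ∉ R' ∧ s.Legal (insert r R') ∧ s.theta OLD (insert r R') = θ := by
  obtain ⟨hne, ⟨L, hL𝒟, hR'L⟩, hsum⟩ := hL
  obtain ⟨D, hD, rfl⟩ := Finset.mem_image.mp hL𝒟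
  have hrR' : r ∉ R' := fun hh => Finset.notMem_erase r D (hR'L hh)
  have hDc : D ∈ s.cones := h.sub hD
  have hnnD := h.wf.nonneg D hDc
  have hsubD : insert r R' ⊆ D :=
    Finset.insert_subset (h.mem_r D hD) (hR'L.trans (Finset.erase_subset r D))
  have hnnM : ∀ x ∈ insert r R', ∀ v, 0 ≤ s.expo x v := fun x hx => hnnD x (hsubD hx)
  -- residual order of R' ∪ {r} is ≥ θ
  have hge : θ ≤ s.theta OLD (insert r R') := by
    rw [le_theta_iff]
    intro v
    rw [psum_insert s OLD hrR']
    by_cases hv : pr v < θ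
    · have h1 := hsum (Sum.inl ⟨v, hv⟩)
      rw [link_fsum_inl s r 𝒟 R' v hv] at h1
      have hpos : 0 < θ - pr v := by linarith
      rw [le_div_iff₀ hpos] at h1
      rw [h.pr_eq v]; linarith
    · push Not at hv
      have := s.psum_nonneg OLD (fun x hx => hnnM x (Finset.mem_insert_of_mem hx)) v
      rw [h.pr_eq v]; linarith
  have hθeq : s.theta OLD (insert r R') = θ :=
    le_antisymm ((s.theta_le_theta_of_subset OLD hsubD hnnD).trans (h.theta_le D hD)) hge
  refine ⟨hrR', ⟨⟨r, Finset.mem_insert_self _ _⟩, ⟨D, hDc, hsubD⟩, fun v => ?_⟩, hθeq⟩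
  -- legality: Σ α + Σ p(v) ≥ (1 − θ) + θ
  rw [s.fsum_eq_asum_add_psum OLD]
  have hp : θ ≤ s.psum OLD (insert r R') v := hθeq ▸ s.theta_le_psum OLD _ v
  have ha : 1 - θ ≤ s.asum OLD (insert r R') := by
    rw [asum_insert s OLD hrR']
    by_cases har : ar < 1 - θ
    · have h1 := hsum (Sum.inr ⟨(), har⟩)
      rw [link_fsum_inr] at h1
      have hpos : 0 < 1 - θ - ar := by linarith
      rw [le_div_iff₀ hpos] at h1
      rw [h.ar_eq]; linarith
    · push Not at har
      have := s.asum_nonneg OLD (fun x hx => hnnM x (Finset.mem_insert_of_mem hx))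
      rw [h.ar_eq]; linarith
  linarith

/-- **(D) JUNIOR-DONE ⟺ INACTIVE UPSTAIRS.**  For a cone `D` through `r` (residual order `≤ θ`), the junior cone
`D − r` is done iff `D` is done or has residual order `< θ` («`E-Max t_n = E-Sing(J_{n−1}, c_n)`», [Blanco2012a,
Prop. 4.1]).  [cite: Blanco2012a, Prop. 4.1, Prop. 3.12] -/
theorem link_done_iff {s : MGame ι} {r : ℕ} {𝒟 : Finset (Finset ℕ)} (h : s.LinkInv OLD θ pr ar n r 𝒟)
    {D : Finset ℕ} (hD : D ∈ 𝒟) :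
    (s.link OLD θ pr ar r 𝒟).Done (D.erase r) ↔ s.Done D ∨ s.theta OLD D < θ := by
  have hrD : r ∈ D := h.mem_r D hD
  have hDc : D ∈ s.cones := h.sub hD
  have hnnD := h.wf.nonneg D hDc
  have hsplitp : ∀ v, s.psum OLD D v = s.pexp OLD r v + s.psum OLD (D.erase r) v := fun v => by
    rw [← psum_insert s OLD (Finset.notMem_erase r D), insert_erase_of_mem hrD]
  have hsplita : s.asum OLD D = s.alpha OLD r + s.asum OLD (D.erase r) := by
    rw [← asum_insert s OLD (Finset.notMem_erase r D), insert_erase_of_mem hrD]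
  constructor
  · rintro ⟨g, hg⟩
    rcases g with ⟨v, hv⟩ | ⟨u, hu⟩
    · right
      rw [link_fsum_inl s r 𝒟 _ v hv] at hg
      have hpos : 0 < θ - pr v := by linarith
      rw [div_lt_iff₀ hpos] at hg
      calc s.theta OLD D ≤ s.psum OLD D v := s.theta_le_psum OLD D v
        _ = s.pexp OLD r v + s.psum OLD (D.erase r) v := hsplitp v
        _ < θ := by rw [h.pr_eq]; linarith
    · by_cases hθD : s.theta OLD D < θ
      · exact Or.inr hθD
      · left
        rw [link_fsum_inr] at hg
        have hpos : 0 < 1 - θ - ar := by linarith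
        rw [div_lt_iff₀ hpos] at hg
        obtain ⟨v, hv⟩ := s.exists_theta_eq OLD D
        refine ⟨v, ?_⟩
        rw [s.fsum_eq_asum_add_psum OLD, hv, hsplita, h.ar_eq]
        have := h.theta_le D hD
        linarith
  · intro hor
    -- the minimiser w of D
    obtain ⟨w, hw⟩ := s.exists_theta_eq OLD D
    by_cases hθD : s.theta OLD D < θ
    · -- w is a junior generator and wins
      have hprw : pr w < θ := by
        rw [← h.pr_eq w]
        have := s.psum_nonneg OLD (R := D.erase r) (fun x hx => hnnD x (Finset.mem_of_mem_erase hx)) w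
        linarith [hsplitp w]
      refine ⟨Sum.inl ⟨w, hprw⟩, ?_⟩
      rw [link_fsum_inl s r 𝒟 _ w hprw]
      have hpos : 0 < θ - pr w := by linarith
      rw [div_lt_iff₀ hpos, ← h.pr_eq w]
      linarith [hsplitp w]
    · have hθD' : s.theta OLD D = θ := le_antisymm (h.theta_le D hD) (le_of_not_gt hθD)
      rcases hor with ⟨v, hv⟩ | hlt
      · -- done with residual order θ: the monomial generator wins
        rw [s.fsum_eq_asum_add_psum OLD] at hv
        have hpv : θ ≤ s.psum OLD D v := hθD' ▸ s.theta_le_psum OLD D v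
        have har : ar < 1 - θ := by
          rw [← h.ar_eq]
          have := s.asum_nonneg OLD (R := D.erase r) (fun x hx => hnnD x (Finset.mem_of_mem_erase hx))
          linarith [hsplita]
        refine ⟨Sum.inr ⟨(), har⟩, ?_⟩
        rw [link_fsum_inr]
        have hpos : 0 < 1 - θ - ar := by linarith
        rw [div_lt_iff₀ hpos, ← h.ar_eq]
        linarith [hsplita]
      · exact absurd hlt hθD

/-- The junior game is a well-formed `(n−1)`-dimensional state. [cite: Blanco2012a, Def. 3.17, Alg. 4.4 (step 4)] -/
theorem link_wf {s : MGame ι} {r : ℕ} {𝒟 : Finset (Finset ℕ)} (h : s.LinkInv OLD θ pr ar n r 𝒟) :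
    (s.link OLD θ pr ar r 𝒟).WF (n - 1) := by
  refine ⟨fun L hL => ?_, fun L hL => ?_, fun L hL x hx g => ?_⟩
  · obtain ⟨D, hD, rfl⟩ := Finset.mem_image.mp hL
    rw [Finset.card_erase_of_mem (h.mem_r D hD), h.wf.card_eq D (h.sub hD)]
  · obtain ⟨D, hD, rfl⟩ := Finset.mem_image.mp hL
    exact (Finset.erase_subset r D).trans (h.wf.subset_used D (h.sub hD))
  · obtain ⟨D, hD, rfl⟩ := Finset.mem_image.mp hL
    have hxD : x ∈ D := Finset.mem_of_mem_erase hx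
    have hnn := h.wf.nonneg D (h.sub hD) x hxD
    rcases g with ⟨v, hv⟩ | ⟨u, hu⟩
    · show 0 ≤ s.pexp OLD x v / (θ - pr v)
      exact div_nonneg (s.pexp_nonneg OLD hnn v) (by linarith)
    · show 0 ≤ s.alpha OLD x / (1 - θ - ar)
      exact div_nonneg (s.alpha_nonneg OLD hnn) (by linarith)

end Link

/-! ## §7 Transforms commute with the junior game ([Blanco2012a, Prop. 3.13]: `(ECoeff_V P)^! = ECoeff_{V′}(P′)`) -/

section LinkMove

variable [Fintype ι] [Nonempty ι] {OLD : Finset ℕ} {θ : ℚ} {pr : ι → ℚ} {ar : ℚ}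

/-- The family of cones through `r` after the move at `M = R' ∪ {r}` with new name `ρ`: members not containing `M` are
kept, members containing `M` are replaced by their children `D − x + ρ`, `x ∈ R'` (the child `D − r + ρ` leaves the
hypersurface of `r`).  [cite: Blanco2012a, Prop. 3.13, Notation 3.27] -/
def descend (𝒟 : Finset (Finset ℕ)) (M R' : Finset ℕ) (ρ : ℕ) : Finset (Finset ℕ) :=
  (𝒟.filter (fun D => ¬ M ⊆ D)) ∪
    ((𝒟.filter (fun D => M ⊆ D)).biUnion (fun D => R'.image (fun x => insert ρ (D.erase x))))

/-- Membership in `descend`. [cite: Blanco2012a, Prop. 3.13] -/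
theorem mem_descend {𝒟 : Finset (Finset ℕ)} {M R' : Finset ℕ} {ρ : ℕ} {E : Finset ℕ} :
    E ∈ descend 𝒟 M R' ρ ↔
      (E ∈ 𝒟 ∧ ¬ M ⊆ E) ∨ ∃ D ∈ 𝒟, M ⊆ D ∧ ∃ x ∈ R', E = insert ρ (D.erase x) := by
  unfold descend
  simp only [Finset.mem_union, Finset.mem_filter, Finset.mem_biUnion, Finset.mem_image]
  constructor
  · rintro (⟨hE, hM⟩ | ⟨D, ⟨hD, hMD⟩, x, hx, hxE⟩)
    · exact Or.inl ⟨hE, hM⟩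
    · exact Or.inr ⟨D, hD, hMD, x, hx, hxE.symm⟩
  · rintro (⟨hE, hM⟩ | ⟨D, hD, hMD, x, hx, rfl⟩)
    · exact Or.inl ⟨hE, hM⟩
    · exact Or.inr ⟨D, ⟨hD, hMD⟩, x, hx, rfl⟩

/-- Two states with the same fields are equal. [folklore] -/
private theorem eq_of_fields {κ : Type} {a b : MGame κ} (h1 : a.cones = b.cones) (h2 : a.expo = b.expo)
    (h3 : a.used = b.used) : a = b := by
  cases a; cases b; cases h1; cases h2; cases h3; rfl

/-- `R' ∪ {r} ⊆ D` iff `R' ⊆ D − r`, for `r ∈ D`, `r ∉ R'`. [folklore] -/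
private theorem insert_subset_iff_subset_erase {D R' : Finset ℕ} {r : ℕ} (hrD : r ∈ D) (hrR' : r ∉ R') :
    insert r R' ⊆ D ↔ R' ⊆ D.erase r := by
  rw [Finset.insert_subset_iff]
  constructor
  · rintro ⟨-, h⟩ x hx
    exact Finset.mem_erase.mpr ⟨ne_of_mem_of_not_mem hx hrR', h hx⟩
  · intro h
    exact ⟨hrD, fun x hx => Finset.mem_of_mem_erase (h hx)⟩

/-- **(M) TRANSFORMS COMMUTE WITH THE JUNIOR GAME.**  Blowing up `R' ∪ {r}` upstairs with the new name `ρ` and then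
passing to the junior game at `r` is the same as passing to the junior game first and blowing up `R'` there with the same
name: the cones correspond (`descend`) and the new ray's junior exponents are `Σ_{R'} e − 1` for every junior generator
(for `v`: `(Σ_{R'} p(v) + p_r(v) − θ)/(θ − p_r(v))`; for `M`: `(Σ_{R'} α + α_r + θ − 1)/(1 − θ − α_r)`).  This is the
commutation `(ECoeff_V(P))^! = ECoeff_{V^∨}(P^∨)` of controlled transforms with coefficient ideals at points where the
order stays maximal.  [cite: Blanco2012a, Prop. 3.13, Cor. 3.3 (conmut-1)] -/
theorem link_move {s : MGame ι} {r ρ : ℕ} {𝒟 : Finset (Finset ℕ)} {R' : Finset ℕ}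
    (hrR' : r ∉ R') (hρO : ρ ∉ OLD) (hρr : ρ ≠ r) (hr𝒟 : ∀ D ∈ 𝒟, r ∈ D)
    (hpr : ∀ v, s.pexp OLD r v = pr v) (har : s.alpha OLD r = ar)
    (hθ : s.theta OLD (insert r R') = θ) :
    (s.move (insert r R') ρ).link OLD θ pr ar r (descend 𝒟 (insert r R') R' ρ) =
      (s.link OLD θ pr ar r 𝒟).move R' ρ := by
  apply eq_of_fields
  · -- cones
    ext E
    simp only [link, Finset.mem_image]
    rw [mem_move_cones]
    simp only [Finset.mem_image]
    constructor
    · rintro ⟨F, hF, rfl⟩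
      rcases mem_descend.mp hF with ⟨hF𝒟, hMF⟩ | ⟨D, hD, hMD, x, hx, rfl⟩
      · refine Or.inl ⟨⟨F, hF𝒟, rfl⟩, ?_⟩
        rwa [← insert_subset_iff_subset_erase (hr𝒟 F hF𝒟) hrR']
      · refine Or.inr ⟨D.erase r, ⟨D, hD, rfl⟩, ?_, x, hx, ?_⟩
        · rwa [← insert_subset_iff_subset_erase (hr𝒟 D hD) hrR']
        · rw [Finset.erase_insert_of_ne hρr, Finset.erase_right_comm]
    · rintro (⟨⟨F, hF𝒟, rfl⟩, hR'F⟩ | ⟨L, ⟨D, hD, rfl⟩, hR'L, x, hx, rfl⟩)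
      · refine ⟨F, mem_descend.mpr (Or.inl ⟨hF𝒟, ?_⟩), rfl⟩
        rwa [insert_subset_iff_subset_erase (hr𝒟 F hF𝒟) hrR']
      · refine ⟨insert ρ (D.erase x), mem_descend.mpr (Or.inr ⟨D, hD, ?_, x, hx, rfl⟩), ?_⟩
        · rwa [insert_subset_iff_subset_erase (hr𝒟 D hD) hrR']
        · rw [Finset.erase_insert_of_ne hρr, Finset.erase_right_comm]
  · -- exponents
    funext x g
    change linkExpo θ pr ar (fun y w => (s.move (insert r R') ρ).pexp OLD y w)
        (fun y => (s.move (insert r R') ρ).alpha OLD y) x g =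
      Function.update (s.link OLD θ pr ar r 𝒟).expo ρ
        (fun w => (s.link OLD θ pr ar r 𝒟).fsum R' w - 1) x g
    by_cases hx : x = ρ
    · rw [hx, Function.update_self]
      rcases g with ⟨v, hv⟩ | ⟨u, hu⟩
      · change (s.move (insert r R') ρ).pexp OLD ρ v / (θ - pr v) =
          (s.link OLD θ pr ar r 𝒟).fsum R' (Sum.inl ⟨v, hv⟩) - 1
        rw [link_fsum_inl s r 𝒟 R' v hv, pexp_move_self s (insert r R') hρO, hθ, psum_insert s OLD hrR', hpr]
        have hne : θ - pr v ≠ 0 := by linarith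
        field_simp
        ring
      · change (s.move (insert r R') ρ).alpha OLD ρ / (1 - θ - ar) =
          (s.link OLD θ pr ar r 𝒟).fsum R' (Sum.inr ⟨u, hu⟩) - 1
        rw [link_fsum_inr, alpha_move_self s (insert r R') hρO, hθ, asum_insert s OLD hrR', har]
        have hne : 1 - θ - ar ≠ 0 := by linarith
        field_simp
        ring
    · rw [Function.update_of_ne hx]
      rcases g with ⟨v, hv⟩ | ⟨u, hu⟩
      · change (s.move (insert r R') ρ).pexp OLD x v / (θ - pr v) = s.pexp OLD x v / (θ - pr v)
        rw [pexp_move_of_ne s _ hx]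
      · change (s.move (insert r R') ρ).alpha OLD x / (1 - θ - ar) = s.alpha OLD x / (1 - θ - ar)
        rw [alpha_move_of_ne s _ hx]
  · -- used names
    rfl

end LinkMove

/-! ## §8 Replaying a junior resolution upstairs; finishing a phase one contact ray at a time; the theorem -/

section Resolution

variable [Fintype ι] [Nonempty ι] {OLD : Finset ℕ} {θ : ℚ} {pr : ι → ℚ} {ar : ℚ} {n N : ℕ}

/-- Contact rays are unchanged on cones avoiding the new name. [cite: Blanco2012a, §3.3] -/
theorem isContact_move_iff (s : MGame ι) (R : Finset ℕ) {ρ : ℕ} {C : Finset ℕ} (hρ : ρ ∉ C) (t : ℕ) :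
    (s.move R ρ).IsContact OLD C t ↔ s.IsContact OLD C t := by
  unfold IsContact
  rw [theta_move_of_not_mem s R hρ]
  constructor
  · rintro ⟨ht, v, hv, hpos⟩
    refine ⟨ht, v, ?_, ?_⟩
    · rwa [psum_move_of_not_mem s R hρ] at hv
    · rwa [pexp_move_of_ne s R (ne_of_mem_of_not_mem ht hρ)] at hpos
  · rintro ⟨ht, v, hv, hpos⟩
    refine ⟨ht, v, ?_, ?_⟩
    · rwa [psum_move_of_not_mem s R hρ]
    · rwa [pexp_move_of_ne s R (ne_of_mem_of_not_mem ht hρ)]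

omit [Fintype ι] [Nonempty ι] in
/-- Untouched cones keep done-ness. [cite: Blanco2012a, Def. 1.24] -/
theorem done_move_iff_of_not_mem (s : MGame ι) (R : Finset ℕ) {ρ : ℕ} {C : Finset ℕ} (hρ : ρ ∉ C) :
    (s.move R ρ).Done C ↔ s.Done C := by
  unfold Done
  simp only [fsum_move_of_not_mem s R hρ]

/-- THE PHASE INVARIANT at level `θ` with the finite set `VALS` of available contact rays: well-formed, common
denominator, old names, `θ` bounds the residual order of not-done cones, and every ACTIVE cone (not done, residual
order `θ`) has a contact ray in `VALS`.  [cite: Blanco2012a, Alg. 4.4, Thm. 4.6 B)] -/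
structure PhaseInv (OLD : Finset ℕ) (θ : ℚ) (n N : ℕ) (VALS : Finset ℕ) (s : MGame ι) : Prop where
  wf : s.WF n
  lattice : s.IsLattice N
  pos : 0 < N
  old_sub : OLD ⊆ s.used
  bound : ∀ C ∈ s.cones, ¬ s.Done C → s.theta OLD C ≤ θ
  contact : ∀ C ∈ s.cones, ¬ s.Done C → s.theta OLD C = θ → ∃ t ∈ VALS, s.IsContact OLD C t

/-- THE REPLAY INVARIANT while the junior game at `r` (family `𝒟`) is being resolved: the junior dictionary hypotheses,
the active members of `𝒟` have `r` as contact ray, the active cones outside `𝒟` have a contact ray in `VALS` other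
than `r`.  [cite: Blanco2012a, Prop. 4.1, Thm. 4.6 B)] -/
structure RepInv (OLD : Finset ℕ) (θ : ℚ) (pr : ι → ℚ) (ar : ℚ) (n N : ℕ) (VALS : Finset ℕ) (s : MGame ι)
    (r : ℕ) (𝒟 : Finset (Finset ℕ)) : Prop where
  linkInv : s.LinkInv OLD θ pr ar n r 𝒟
  lattice : s.IsLattice N
  pos : 0 < N
  contact_in : ∀ D ∈ 𝒟, ¬ s.Done D → s.theta OLD D = θ → s.IsContact OLD D r
  contact_out : ∀ C ∈ s.cones, C ∉ 𝒟 → ¬ s.Done C → s.theta OLD C = θ →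
    ∃ t ∈ VALS, t ≠ r ∧ s.IsContact OLD C t

/-- A cone containing an allowed centre has residual order exactly `θ`. [cite: Blanco2012a, Prop. 4.1] -/
theorem theta_eq_of_allowed {s : MGame ι} (hW : s.WF n) (hb : ∀ C ∈ s.cones, ¬ s.Done C → s.theta OLD C ≤ θ)
    {M C : Finset ℕ} (hM : s.Legal M) (hθM : s.theta OLD M = θ) (hC : C ∈ s.cones) (hMC : M ⊆ C) :
    s.theta OLD C = θ :=
  le_antisymm (hb C hC (not_done_of_legal_subset hW hC hMC hM))
    (hθM ▸ s.theta_le_theta_of_subset OLD hMC (hW.nonneg C hC))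

/-- THE REPLAY INVARIANT IS PRESERVED by an allowed move `R' ∪ {r}` (with any fresh name), the family descending to
`descend 𝒟 (R' ∪ {r}) R' ρ`.  [cite: Blanco2012a, Prop. 4.1, Prop. 3.13] -/
theorem RepInv.move {VALS : Finset ℕ} {s : MGame ι} {r : ℕ} {𝒟 : Finset (Finset ℕ)}
    (h : s.RepInv OLD θ pr ar n N VALS r 𝒟) {R' : Finset ℕ} (hrR' : r ∉ R') (hM : s.Legal (insert r R'))
    (hθM : s.theta OLD (insert r R') = θ) {ρ : ℕ} (hρ : s.Fresh ρ) :
    (s.move (insert r R') ρ).RepInv OLD θ pr ar n N VALS r (descend 𝒟 (insert r R') R' ρ) := by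
  have hW := h.linkInv.wf
  have hρO : ρ ∉ OLD := fun hh => hρ (h.linkInv.old_sub hh)
  have hρr : ρ ≠ r := fun hh => hρ (hh ▸ h.linkInv.r_used)
  have hρC : ∀ C ∈ s.cones, ρ ∉ C := fun C hC => not_mem_of_fresh hW hρ hC
  have hθC : ∀ C ∈ s.cones, insert r R' ⊆ C → s.theta OLD C = θ :=
    fun C hC hMC => theta_eq_of_allowed hW h.linkInv.bound hM hθM hC hMC
  -- children have residual order ≤ θ
  have hchild_le : ∀ C ∈ s.cones, insert r R' ⊆ C → ∀ x ∈ C,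
      (s.move (insert r R') ρ).theta OLD (insert ρ (C.erase x)) ≤ θ := by
    intro C hC hMC x hx
    have := s.theta_child_le (OLD := OLD) hMC hx (hρC C hC) hρO (hW.nonneg C hC) (by rw [hθM, hθC C hC hMC])
    rwa [hθC C hC hMC] at this
  refine ⟨⟨hW.move hM hρ, h.linkInv.old_sub.trans (Finset.subset_insert _ _),
      Finset.mem_insert_of_mem h.linkInv.r_used, fun v => ?_, ?_, ?_, ?_, ?_, ?_⟩, h.lattice.move hW hM hρ, h.pos, ?_, ?_⟩
  · rw [pexp_move_of_ne s _ hρr.symm]; exact h.linkInv.pr_eq v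
  · rw [alpha_move_of_ne s _ hρr.symm]; exact h.linkInv.ar_eq
  · -- descend ⊆ cones'
    intro E hE
    rcases mem_descend.mp hE with ⟨hE𝒟, hME⟩ | ⟨D, hD, hMD, x, hx, rfl⟩
    · exact mem_move_cones_of_not_subset ρ (h.linkInv.sub hE𝒟) hME
    · exact child_mem_move_cones ρ (h.linkInv.sub hD) hMD (Finset.mem_insert_of_mem hx)
  · -- r ∈ every member
    intro E hE
    rcases mem_descend.mp hE with ⟨hE𝒟, -⟩ | ⟨D, hD, hMD, x, hx, rfl⟩
    · exact h.linkInv.mem_r E hE𝒟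
    · exact Finset.mem_insert_of_mem
        (Finset.mem_erase.mpr ⟨fun hh => hrR' (hh ▸ hx), h.linkInv.mem_r D hD⟩)
  · -- residual order ≤ θ on the family
    intro E hE
    rcases mem_descend.mp hE with ⟨hE𝒟, -⟩ | ⟨D, hD, hMD, x, hx, rfl⟩
    · rw [theta_move_of_not_mem s _ (hρC E (h.linkInv.sub hE𝒟))]; exact h.linkInv.theta_le E hE𝒟
    · exact hchild_le D (h.linkInv.sub hD) hMD x (hMD (Finset.mem_insert_of_mem hx))
  · -- bound on all not-done cones
    intro C' hC' hd'
    rcases mem_move_cones.mp hC' with ⟨hC, hMC⟩ | ⟨C, hC, hMC, x, hx, rfl⟩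
    · rw [theta_move_of_not_mem s _ (hρC C' hC)]
      exact h.linkInv.bound C' hC (fun hd => hd' ((done_move_iff_of_not_mem s _ (hρC C' hC)).mpr hd))
    · exact hchild_le C hC hMC x (hMC hx)
  · -- active members of the new family have contact ray r
    intro E hE hdE hθE
    rcases mem_descend.mp hE with ⟨hE𝒟, hME⟩ | ⟨D, hD, hMD, x, hx, rfl⟩
    · have hρE := hρC E (h.linkInv.sub hE𝒟)
      rw [isContact_move_iff s _ hρE]
      rw [theta_move_of_not_mem s _ hρE] at hθE
      exact h.contact_in E hE𝒟 (fun hd => hdE ((done_move_iff_of_not_mem s _ hρE).mpr hd)) hθE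
    · have hDc := h.linkInv.sub hD
      have hθD := hθC D hDc hMD
      have hcD : s.IsContact OLD D r :=
        h.contact_in D hD (not_done_of_legal_subset hW hDc hMD hM) hθD
      exact hcD.child hMD (hMD (Finset.mem_insert_of_mem hx)) (hρC D hDc) hρO (hW.nonneg D hDc)
        (by rw [hθM, hθD]) (by rw [hθE, hθD])
  · -- active cones outside the new family have a contact ray in VALS other than r
    intro C' hC' hnot hd' hθ'
    rcases mem_move_cones.mp hC' with ⟨hC, hMC⟩ | ⟨C, hC, hMC, x, hx, rfl⟩
    · have hρC' := hρC C' hC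
      have hnot𝒟 : C' ∉ 𝒟 := fun hh => hnot (mem_descend.mpr (Or.inl ⟨hh, hMC⟩))
      rw [theta_move_of_not_mem s _ hρC'] at hθ'
      obtain ⟨t, ht, htr, hct⟩ := h.contact_out C' hC hnot𝒟
        (fun hd => hd' ((done_move_iff_of_not_mem s _ hρC').mpr hd)) hθ'
      exact ⟨t, ht, htr, (isContact_move_iff s _ hρC' t).mpr hct⟩
    · have hθCθ := hθC C hC hMC
      have hndC := not_done_of_legal_subset hW hC hMC hM
      by_cases hC𝒟 : C ∈ 𝒟
      · -- a child of a member: either it is in the new family (x ∈ R') or it is the dropped child (x = r)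
        rcases Finset.mem_insert.mp hx with rfl | hxR'
        · exact absurd hθ' (ne_of_lt (lt_of_lt_of_eq
            ((h.contact_in C hC𝒟 hndC hθCθ).theta_child_lt hMC (hρC C hC) hρO (hW.nonneg C hC)
              (by rw [hθM, hθCθ])) hθCθ))
        · exact absurd (mem_descend.mpr (Or.inr ⟨C, hC𝒟, hMC, x, hxR', rfl⟩)) hnot
      · obtain ⟨t, ht, htr, hct⟩ := h.contact_out C hC hC𝒟 hndC hθCθ
        exact ⟨t, ht, htr, hct.child hMC (hMC hx) (hρC C hC) hρO (hW.nonneg C hC)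
          (by rw [hθM, hθCθ]) (by rw [hθ', hθCθ])⟩

/-- When the junior game of the family is entirely done, no member is active, and the phase invariant holds with `r`
removed from the available contact rays.  [cite: Blanco2012a, Prop. 4.1] -/
theorem RepInv.phaseInv_of_allDone {VALS : Finset ℕ} {s : MGame ι} {r : ℕ} {𝒟 : Finset (Finset ℕ)}
    (h : s.RepInv OLD θ pr ar n N VALS r 𝒟) (hall : (s.link OLD θ pr ar r 𝒟).AllDone) :
    s.PhaseInv OLD θ n N (VALS.erase r) := by
  refine ⟨h.linkInv.wf, h.lattice, h.pos, h.linkInv.old_sub, h.linkInv.bound, fun C hC hd hθC => ?_⟩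
  by_cases hC𝒟 : C ∈ 𝒟
  · have := hall (C.erase r) (Finset.mem_image_of_mem _ hC𝒟)
    rcases (link_done_iff h.linkInv hC𝒟).mp this with hdone | hlt
    · exact absurd hdone hd
    · exact absurd hθC (ne_of_lt hlt)
  · obtain ⟨t, ht, htr, hct⟩ := h.contact_out C hC hC𝒟 hd hθC
    exact ⟨t, Finset.mem_erase.mpr ⟨htr, ht⟩, hct⟩

/-- **REPLAY.**  A resolution of the junior game at `r` (a `Solvable` derivation, fresh names adversarial) lifts move
by move to legal moves `R' ∪ {r}` upstairs ([Blanco2012a, Prop. 4.1]: the induced sequence in dimension `n − 1`);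
when it ends, `r` has left the set of available contact rays and the continuation `K` takes over.
[cite: Blanco2012a, Prop. 4.1, Thm. 4.6 B)] -/
theorem replay {VALS : Finset ℕ} {r : ℕ}
    (K : ∀ s' : MGame ι, s'.PhaseInv OLD θ n N (VALS.erase r) → s'.Solvable) :
    ∀ (L : MGame (LinkGen ι θ pr ar)), L.Solvable →
      ∀ (s : MGame ι) (𝒟 : Finset (Finset ℕ)), s.RepInv OLD θ pr ar n N VALS r 𝒟 →
        s.link OLD θ pr ar r 𝒟 = L → s.Solvable := by
  intro L hL
  induction hL with
  | done hall =>
    intro s 𝒟 h hsL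
    subst hsL
    exact K s (h.phaseInv_of_allDone hall)
  | step R' hleg _ ih =>
    intro s 𝒟 h hsL
    subst hsL
    obtain ⟨hrR', hM, hθM⟩ := legal_insert_of_link_legal h.linkInv hleg
    refine Solvable.step (insert r R') hM (fun ρ hρ => ?_)
    have hρO : ρ ∉ OLD := fun hh => hρ (h.linkInv.old_sub hh)
    have hρr : ρ ≠ r := fun hh => hρ (hh ▸ h.linkInv.r_used)
    refine ih ρ hρ (s.move (insert r R') ρ) (descend 𝒟 (insert r R') R' ρ) (h.move hrR' hM hθM hρ) ?_
    exact link_move hrR' hρO hρr h.linkInv.mem_r h.linkInv.pr_eq h.linkInv.ar_eq hθM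

end Resolution

/-! ### Finishing a phase one contact ray at a time, and the theorem -/

section Main

variable [Fintype ι] [Nonempty ι] {OLD : Finset ℕ} {θ : ℚ} {n N : ℕ}

/-- Sums of `N`-lattice values are `N`-lattice values. [folklore] -/
private theorem exists_sum_eq_div' (N : ℕ) {T : Finset ℕ} (f : ℕ → ℚ) (h : ∀ r ∈ T, ∃ z : ℤ, f r = z / N) :
    ∃ z : ℤ, ∑ r ∈ T, f r = z / N := by
  classical
  induction T using Finset.induction_on with
  | empty => exact ⟨0, by simp⟩
  | insert a T ha ih =>
    obtain ⟨z, hz⟩ := ih (fun r hr => h r (Finset.mem_insert_of_mem hr))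
    obtain ⟨w, hw⟩ := h a (Finset.mem_insert_self _ _)
    refine ⟨w + z, ?_⟩
    rw [Finset.sum_insert ha, hw, hz]
    push_cast
    ring

/-- Residual orders are `N`-lattice values on subfaces of cones. [cite: Blanco2012a, Alg. 4.4 (step 2)] -/
theorem exists_theta_eq_div (s : MGame ι) (hL : s.IsLattice N) {C T : Finset ℕ} (hC : C ∈ s.cones)
    (hT : T ⊆ C) : ∃ z : ℤ, s.theta OLD T = z / N := by
  obtain ⟨v, hv⟩ := s.exists_theta_eq OLD T
  rw [← hv]
  unfold psum pexp
  refine exists_sum_eq_div' N _ (fun r hr => ?_)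
  obtain ⟨z, hz⟩ := hL C hC r (hT hr) v
  obtain ⟨w, hw⟩ := s.exists_alpha_eq_div (OLD := OLD) hL hC (hT hr)
  exact ⟨z - w, by rw [hz, hw]; push_cast; ring⟩

/-- **FINISHING A PHASE, ONE CONTACT RAY AT A TIME.**  At level `θ > 0`, with the available contact rays in a finite set
`VALS`: pick a contact ray `r` of an active cone, let `𝒟` be the active cones having `r` as a contact ray; if the junior
game at `r` has no generator the divisor move `{r}` finishes them ([Blanco2012a, Prop. 3.16: `ECoeff = 0`, the centre is
the hypersurface]); otherwise the junior game is an `(n−1)`-dimensional well-formed state, solvable by the induction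
hypothesis on the dimension, and its resolution is REPLAYED; either way `r` leaves `VALS`, the other active cones keep
their (inherited) contact rays, and finished cones are never touched again.  Induction on `|VALS|`.
[cite: Blanco2012a, Alg. 4.4, Prop. 4.1, Thm. 4.6 B)] -/
theorem phase
    (IHdim : ∀ (G : Type) [Fintype G] [Nonempty G] (L : MGame G), L.WF (n - 1) → L.Solvable)
    (Kout : ∀ s' : MGame ι, s'.PhaseInv OLD θ n N ∅ → s'.Solvable) :
    ∀ (k : ℕ) (VALS : Finset ℕ) (s : MGame ι), VALS.card ≤ k → s.PhaseInv OLD θ n N VALS → s.Solvable := by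
  intro k
  induction k with
  | zero =>
    intro VALS s hcard hP
    have hV : VALS = ∅ := Finset.card_eq_zero.mp (Nat.le_zero.mp hcard)
    subst hV
    exact Kout s hP
  | succ k ih =>
    intro VALS s hcard hP
    classical
    by_cases hact : ∃ C ∈ s.cones, ¬ s.Done C ∧ s.theta OLD C = θ
    swap
    · -- no active cone: the phase is over
      refine Kout s ⟨hP.wf, hP.lattice, hP.pos, hP.old_sub, hP.bound, fun C hC hd hθC => ?_⟩
      exact absurd ⟨C, hC, hd, hθC⟩ hact
    obtain ⟨C₀, hC₀, hd₀, hθ₀⟩ := hact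
    obtain ⟨r, hrV, hcr⟩ := hP.contact C₀ hC₀ hd₀ hθ₀
    have hW := hP.wf
    have hrC₀ : r ∈ C₀ := hcr.1
    have hnn₀ := hW.nonneg C₀ hC₀
    -- the family of active cones with contact ray r, and r's frozen data
    set 𝒟 : Finset (Finset ℕ) :=
      s.cones.filter (fun C => ¬ s.Done C ∧ s.theta OLD C = θ ∧ s.IsContact OLD C r) with h𝒟
    set pr : ι → ℚ := fun v => s.pexp OLD r v with hpr
    set ar : ℚ := s.alpha OLD r with har
    have hmem𝒟 : ∀ {C}, C ∈ 𝒟 ↔ C ∈ s.cones ∧ ¬ s.Done C ∧ s.theta OLD C = θ ∧ s.IsContact OLD C r := by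
      intro C; rw [h𝒟, Finset.mem_filter]
    have hRep : s.RepInv OLD θ pr ar n N VALS r 𝒟 := by
      refine ⟨⟨hW, hP.old_sub, hW.subset_used C₀ hC₀ hrC₀, fun v => rfl, rfl,
        fun C hC => (hmem𝒟.mp hC).1, fun C hC => (hmem𝒟.mp hC).2.2.2.1,
        fun C hC => le_of_eq (hmem𝒟.mp hC).2.2.1, hP.bound⟩, hP.lattice, hP.pos,
        fun C hC _ _ => (hmem𝒟.mp hC).2.2.2, fun C hC hC𝒟 hd hθC => ?_⟩
      obtain ⟨t, ht, hct⟩ := hP.contact C hC hd hθC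
      refine ⟨t, ht, fun htr => hC𝒟 (hmem𝒟.mpr ⟨hC, hd, hθC, htr ▸ hct⟩), hct⟩
    have hcard' : (VALS.erase r).card ≤ k := by
      rw [Finset.card_erase_of_mem hrV]; omega
    -- continuation after the component of r is finished
    have K : ∀ s' : MGame ι, s'.PhaseInv OLD θ n N (VALS.erase r) → s'.Solvable :=
      fun s' hP' => ih (VALS.erase r) s' hcard' hP'
    by_cases hgen : Nonempty (LinkGen ι θ pr ar)
    · -- the junior game has generators: solve it by the induction hypothesis on the dimension and replay
      have hLWF := link_wf hRep.linkInv
      exact replay K (s.link OLD θ pr ar r 𝒟) (IHdim _ _ hLWF) s 𝒟 hRep rfl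
    · -- no junior generator: the divisor move {r} finishes every active cone through r
      rw [not_nonempty_iff] at hgen
      have hpθ : ∀ v, θ ≤ s.pexp OLD r v := fun v => by
        by_contra hlt; push Not at hlt
        exact hgen.false (Sum.inl ⟨v, hlt⟩)
      have haθ : 1 - θ ≤ s.alpha OLD r := by
        by_contra hlt; push Not at hlt
        exact hgen.false (Sum.inr ⟨(), hlt⟩)
      have hLegal : s.Legal {r} := by
        refine ⟨⟨r, Finset.mem_singleton_self r⟩, ⟨C₀, hC₀, Finset.singleton_subset_iff.mpr hrC₀⟩, fun v => ?_⟩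
        rw [fsum, Finset.sum_singleton, s.expo_eq_alpha_add_pexp OLD]
        linarith [hpθ v]
      have hθr : s.theta OLD {r} = θ := by
        apply le_antisymm
        · calc s.theta OLD {r} ≤ s.theta OLD C₀ :=
              s.theta_le_theta_of_subset OLD (Finset.singleton_subset_iff.mpr hrC₀) hnn₀
            _ = θ := hθ₀
        · rw [le_theta_iff]; intro v; rw [psum, Finset.sum_singleton]; exact hpθ v
      refine Solvable.step {r} hLegal (fun ρ hρ => K _ ?_)
      have hρO : ρ ∉ OLD := fun hh => hρ (hP.old_sub hh)
      have hρC : ∀ C ∈ s.cones, ρ ∉ C := fun C hC => not_mem_of_fresh hW hρ hC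
      -- every cone through r is active with contact ray r, and its child drops
      have hdrop : ∀ C ∈ s.cones, {r} ⊆ C → ∀ x ∈ ({r} : Finset ℕ),
          (s.move {r} ρ).theta OLD (insert ρ (C.erase x)) < θ := by
        intro C hC hrC x hx
        rw [Finset.mem_singleton] at hx; subst hx
        have hθC : s.theta OLD C = θ := theta_eq_of_allowed hW hP.bound hLegal hθr hC hrC
        have hndC := not_done_of_legal_subset hW hC hrC hLegal
        obtain ⟨t, -, hct⟩ := hP.contact C hC hndC hθC
        have htr : t = x := Finset.mem_singleton.mp
          (hct.mem_of_theta_eq hrC (hW.nonneg C hC) (by rw [hθr, hθC]))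
        subst htr
        have := hct.theta_child_lt hrC (hρC C hC) hρO (hW.nonneg C hC) (by rw [hθr, hθC])
        rwa [hθC] at this
      refine ⟨hW.move hLegal hρ, hP.lattice.move hW hLegal hρ, hP.pos,
        hP.old_sub.trans (Finset.subset_insert _ _), fun C' hC' hd' => ?_, fun C' hC' hd' hθ' => ?_⟩
      · rcases mem_move_cones.mp hC' with ⟨hC, hrC⟩ | ⟨C, hC, hrC, x, hx, rfl⟩
        · rw [theta_move_of_not_mem s _ (hρC C' hC)]
          exact hP.bound C' hC (fun hd => hd' ((done_move_iff_of_not_mem s _ (hρC C' hC)).mpr hd))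
        · exact (hdrop C hC hrC x hx).le
      · rcases mem_move_cones.mp hC' with ⟨hC, hrC⟩ | ⟨C, hC, hrC, x, hx, rfl⟩
        · have hρC' := hρC C' hC
          rw [theta_move_of_not_mem s _ hρC'] at hθ'
          obtain ⟨t, ht, hct⟩ := hP.contact C' hC
            (fun hd => hd' ((done_move_iff_of_not_mem s _ hρC').mpr hd)) hθ'
          have htr : t ≠ r := fun htr => hrC (Finset.singleton_subset_iff.mpr (htr ▸ hct.1))
          exact ⟨t, Finset.mem_erase.mpr ⟨htr, ht⟩, (isContact_move_iff s _ hρC' t).mpr hct⟩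
        · exact absurd hθ' (ne_of_lt (hdrop C hC hrC x hx))

/-- **E-RESOLUTION OF MARKED MONOMIAL IDEALS EXISTS, IN EVERY DIMENSION (Blanco 2012a Thm. 4.6, monomial case, abstract
form).**  Every well-formed state of the marked monomial game — any finite complex of `n`-cones over named rays with
non-negative rational exponents and a non-empty finite set of generators — is solvable: some finite sequence of legal
single-face blow-ups (with ANY fresh names) reaches a state all of whose cones are done (`E-Sing(J, c) = ∅`).  Proof
by induction on `n`; in dimension `n`, by induction on `N·θ_max` (residual order of the not-done cones, common
denominator `N`): `θ_max = 0` is the monomial phase ([EncinasVillamayor1998, §2]); `θ_max > 0` is finished one contact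
ray at a time by junior games in dimension `n − 1` (`phase`), after which `θ_max` has dropped.
[cite: Blanco2012a, Thm. 4.6 C) (monomial case, via Alg. 4.4 and Prop. 4.1); EncinasVillamayor1998, §2] -/
theorem solvable_of_wf : ∀ (n : ℕ) (κ : Type) [Fintype κ] [Nonempty κ] (s : MGame κ), s.WF n → s.Solvable := by
  intro n
  induction n using Nat.strong_induction_on with
  | _ n IHn =>
  intro κ _ _ s₀ hW₀
  classical
  obtain ⟨N, hN, hL₀⟩ := s₀.exists_isLattice
  have hNq : (0 : ℚ) < N := by exact_mod_cast hN
  -- induction on N·θ_max, the old names being those of s₀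
  suffices H : ∀ (k : ℕ) (s : MGame κ), s.WF n → s.IsLattice N → s₀.used ⊆ s.used →
      (∀ C ∈ s.cones, ¬ s.Done C → (N : ℚ) * s.theta s₀.used C ≤ k) → s.Solvable by
    refine H (∑ C ∈ s₀.cones, (⌊(N : ℚ) * s₀.theta s₀.used C⌋₊ + 1)) s₀ hW₀ hL₀ le_rfl (fun C hC _ => ?_)
    have h1 : (N : ℚ) * s₀.theta s₀.used C < (⌊(N : ℚ) * s₀.theta s₀.used C⌋₊ : ℕ) + 1 := Nat.lt_floor_add_one _
    have h2 : (⌊(N : ℚ) * s₀.theta s₀.used C⌋₊ + 1 : ℕ) ≤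
        ∑ C ∈ s₀.cones, (⌊(N : ℚ) * s₀.theta s₀.used C⌋₊ + 1) :=
      Finset.single_le_sum (f := fun C => ⌊(N : ℚ) * s₀.theta s₀.used C⌋₊ + 1) (fun _ _ => Nat.zero_le _) hC
    have h2' : (((⌊(N : ℚ) * s₀.theta s₀.used C⌋₊ + 1 : ℕ)) : ℚ) ≤
        ((∑ C ∈ s₀.cones, (⌊(N : ℚ) * s₀.theta s₀.used C⌋₊ + 1) : ℕ) : ℚ) := by exact_mod_cast h2
    push_cast at h1 h2' ⊢
    linarith
  intro k
  induction k using Nat.strong_induction_on with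
  | _ k IHk =>
  intro s hW hL hO hbound
  by_cases hk : k = 0
  · -- residual order 0 everywhere: the monomial phase
    subst hk
    refine MonomialPhase.solvable (OLD := s₀.used) (N := N) ⟨hW, hN, hL, hO, fun C hC hd => ?_⟩
    have h1 := hbound C hC hd
    push_cast at h1
    by_contra hpos
    push Not at hpos
    nlinarith
  · -- level θ = k / N > 0
    have hk1 : 1 ≤ k := Nat.pos_of_ne_zero hk
    by_cases hlow : ∀ C ∈ s.cones, ¬ s.Done C → (N : ℚ) * s.theta s₀.used C ≤ (k - 1 : ℕ)
    · exact IHk (k - 1) (by omega) s hW hL hO hlow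
    · push Not at hlow
      obtain ⟨C₁, hC₁, hd₁, hgt⟩ := hlow
      set θ : ℚ := (k : ℚ) / N with hθdef
      have hθpos : 0 < θ := div_pos (by exact_mod_cast hk1) hNq
      have hb : ∀ C ∈ s.cones, ¬ s.Done C → s.theta s₀.used C ≤ θ := fun C hC hd => by
        rw [hθdef, le_div_iff₀ hNq, mul_comm]; exact hbound C hC hd
      -- C₁ sits exactly at level θ (N·θ(C₁) is an integer in (k−1, k])
      have hθ₁ : s.theta s₀.used C₁ = θ := by
        refine le_antisymm (hb C₁ hC₁ hd₁) ?_
        obtain ⟨z, hz⟩ := s.exists_theta_eq_div (OLD := s₀.used) hL hC₁ (subset_refl _)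
        rw [hz] at hgt ⊢
        rw [mul_div_cancel₀ _ hNq.ne'] at hgt
        have hkz : ((k - 1 : ℕ) : ℤ) < z := by exact_mod_cast hgt
        have hkz' : (k : ℤ) ≤ z := by omega
        have hkq : (k : ℚ) ≤ z := by exact_mod_cast hkz'
        rw [hθdef]
        exact div_le_div_of_nonneg_right hkq hNq.le
      -- C₁ has a contact ray, so n ≥ 1
      obtain ⟨r₁, hr₁⟩ := s.exists_isContact (OLD := s₀.used) (D := C₁) (by rw [hθ₁]; exact hθpos)
      have hn : 1 ≤ n := by
        rw [← hW.card_eq C₁ hC₁]; exact Finset.card_pos.mpr ⟨r₁, hr₁.1⟩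
      -- the phase invariant with all rays available as contact rays
      have hP : s.PhaseInv s₀.used θ n N (s.cones.biUnion id) := by
        refine ⟨hW, hL, hN, hO, hb, fun C hC hd hθC => ?_⟩
        obtain ⟨r, hr⟩ := s.exists_isContact (OLD := s₀.used) (D := C) (by rw [hθC]; exact hθpos)
        exact ⟨r, Finset.mem_biUnion.mpr ⟨C, hC, hr.1⟩, hr⟩
      refine phase (fun G _ _ L hLW => IHn (n - 1) (by omega) G L hLW) (fun s' hP' => ?_)
        _ _ s le_rfl hP
      -- after the phase: every not-done cone is strictly below θ, i.e. N·θ(C) ≤ k − 1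
      refine IHk (k - 1) (by omega) s' hP'.wf hP'.lattice hP'.old_sub (fun C hC hd => ?_)
      have hle := hP'.bound C hC hd
      have hne : s'.theta s₀.used C ≠ θ := by
        intro hθC
        obtain ⟨t, ht, -⟩ := hP'.contact C hC hd hθC
        simp at ht
      have hlt : s'.theta s₀.used C < θ := lt_of_le_of_ne hle hne
      obtain ⟨z, hz⟩ := s'.exists_theta_eq_div (OLD := s₀.used) hP'.lattice hC (subset_refl _)
      rw [hz] at hlt ⊢
      rw [mul_div_cancel₀ _ hNq.ne']
      rw [hθdef, div_lt_div_iff_of_pos_right hNq] at hlt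
      have hzk : z < (k : ℤ) := by exact_mod_cast hlt
      have hzk' : z ≤ ((k - 1 : ℕ) : ℤ) := by omega
      exact_mod_cast hzk'

end Main

end MGame

end Literature.Combinatorics.HironakaPolyhedraGame
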